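import Literature.MathematicalPhysics.QuantumLattice.HubbardOpenBoxCodedClusterCertificate
import Literature.MathematicalPhysics.QuantumLattice.HubbardOpenBoxEDCertificateKroneckerBlocks
import HarnessLib

/-!
# Data-free floors of a GENERAL coded cluster: row blocks, spin-exchange symmetry, assembly

Topic `MathematicalPhysics/QuantumLattice`, family `hubbard`. Companion of
`HubbardOpenBoxCodedClusterCertificate` (generic checker `KCert.checkG` over a coded cluster oracle
`O : CodedCluster` and its soundness `KCert.soundG`). Here, exactly as `HubbardOpenBoxEDCertificateKroneckerBlocks`
/ `…KroneckerSwap` do for the uniform `t–t'` cluster: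

* §1 the check in PIECES the kernel evaluates in separate declarations — `KCert.checkBaseG` (everything
  but the residual rows) and `KCert.checkRowsG i₀ c` (diagonal dominance of residual rows `i₀ … i₀+c−1`),
  `KCert.PassesG` (base `∧` all rows), `rowPassG_of_checkRowsG`, **`checkG_of_passesG`** /
  `passesG_of_checkG`, and `KCert.soundG₂` (Neumaier 2004 §11: certificates checked piecewise);
* §2 the ASSEMBLY over the spin sectors of a particle number: **`groundEnergy_ge_of_kCertsG`** (all
  sectors `(p, k − p)`), **`groundEnergy_ge_of_kCertsG₂`** (sectors `p ≤ k − p` only, for a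
  spin-exchange-invariant `H`, `relabel Orb.spinSwap H = H`; the others are images, Lieb 1989), and
  **`groundEnergy_ge_of_kCertsG₃`** (the same from `PassesG`): `σ ≤ E₀(H, k)`, the hypothesis of the
  Anderson / Valentí–Stolze–Hirschfeld cluster bounds.

Everything is proved; no named fact; nothing numerical is asserted here.

## References

* A. Neumaier, Acta Numerica 13 (2004), §11 (certificates checked piecewise). [cite: Neumaier2004CompleteSearch, §11]
* S. M. Rump, BIT 46 (2006) 433, §2. [cite: Rump2006PosDef, §2]
* I. Kull, N. Schuch, B. Dive, M. Navascués, PRX 14 (2024) 021008, §5.3. [cite: KullEtAl2024, §5.3]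
* E. H. Lieb, PRL 62 (1989) 1201, proof of Thm 1 (spin sectors; spin exchange). [cite: LiebPRL1989, proof of Theorem 1]
* P. W. Anderson, Phys. Rev. 83 (1951) 1260, eq. (2) (cluster lower bounds). [cite: Anderson1951, eq. (2)]
-/

namespace Literature.MathematicalPhysics.QuantumLattice

namespace OccupationCode

open Finset Matrix Literature.Computation.Certificates Literature.Computation.Certificates.PSD
  Literature.Computation.Certificates.PSD.Packed

/-! ### §1 The generic check in pieces -/

namespace KCert

variable (C : KCert)

/-- **Base check** (generic): everything in `checkG` except the residual rows (sector list, rank table,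
no-carry bounds, factor length, peel of every factor row). [cite: Rump2006PosDef, §2] -/
def checkBaseG (O : CodedCluster) (a b p q Q : ℕ) (L : List ℕ) : Bool :=
  let n := L.length
  let X := 2 ^ C.x
  let OA := 2 ^ (C.y - 1)
  let RT := rankTab L 0
  let P := C.factorOfG O L
  decide (0 < Q) && decide (0 < C.K) && decide (1 ≤ C.y) && sectorListOK a b p q L && rankOK RT L 0 &&
    decide (C.K * (O.bound + C.c.natAbs) < OA) &&
    (P.length == n) && P.all (fun r => peelOK X (2 * C.O) (List.replicate n 1) r.p 0 0 r.r r.t) &&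
    decide (n * (2 * C.O) ^ 2 < X)

/-- Residual row `i` passes (generic: `rowOK` on the `i`-th oracle row and factor row). [cite: Rump2006PosDef, §2] -/
def rowPassG (O : CodedCluster) (L : List ℕ) (i : ℕ) : Bool :=
  rowOK C.y C.x (C.x * (L.length - 1)) C.O (2 ^ (C.y - 1)) L.length ((C.rowsOfG O L).getD i 0)
    ((C.factorOfG O L).getD i ⟨0, 0, 0⟩) i (C.factorOfG O L)

/-- **Row-block check** (generic): rows `i₀, …, i₀ + c − 1` pass (ONE kernel declaration per block; the
untrusted factor is recomputed in each). [cite: Neumaier2004CompleteSearch, §11] -/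
def checkRowsG (O : CodedCluster) (L : List ℕ) (i₀ c : ℕ) : Bool :=
  allFrom (C.rowPassG O L) i₀ c

/-- **A generic certificate passes in pieces**: base check and every residual row. [cite: Rump2006PosDef, §2] -/
def PassesG (O : CodedCluster) (a b p q Q : ℕ) (L : List ℕ) : Prop :=
  C.checkBaseG O a b p q Q L = true ∧ ∀ i < L.length, C.rowPassG O L i = true

/-- Rows of a passing block pass. [cite: Neumaier2004CompleteSearch, §11] -/
theorem rowPassG_of_checkRowsG {O : CodedCluster} {L : List ℕ} {i₀ c : ℕ}
    (h : C.checkRowsG O L i₀ c = true) : ∀ i, i₀ ≤ i → i < i₀ + c → C.rowPassG O L i = true :=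
  allFrom_spec _ i₀ c h

/-- `ddAllN` succeeds when every row passes (completeness of the walk). [folklore] -/
private theorem ddAllN_of_rows' (y x sh O OA n : ℕ) (P : List Row) :
    ∀ (i₀ : ℕ) (RAs : List ℕ) (qs : List Row), RAs.length = qs.length →
      (∀ k < qs.length, rowOK y x sh O OA n (RAs.getD k 0) (qs.getD k ⟨0, 0, 0⟩) (i₀ + k) P = true) →
      ddAllN y x sh O OA n P i₀ RAs qs = true
  | _, [], [], _, _ => rfl
  | _, [], _ :: _, hl, _ => by simp at hl
  | _, _ :: _, [], hl, _ => by simp at hl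
  | i₀, RA :: RAs, qi :: qs, hl, h => by
      rw [ddAllN, Bool.and_eq_true]
      refine ⟨by simpa using h 0 (by simp), ddAllN_of_rows' y x sh O OA n P (i₀ + 1) RAs qs (by simpa using hl) ?_⟩
      intro k hk
      have := h (k + 1) (by simpa using hk)
      simpa [add_assoc, add_comm 1 k] using this

/-- The one Boolean is the base check and the residual walk. [cite: Rump2006PosDef, §2] -/
private theorem checkG_eq' (O : CodedCluster) (a b p q Q : ℕ) (L : List ℕ) :
    C.checkG O a b p q Q L = (C.checkBaseG O a b p q Q L &&
      ddAllN C.y C.x (C.x * (L.length - 1)) C.O (2 ^ (C.y - 1)) L.length (C.factorOfG O L) 0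
        (C.rowsOfG O L) (C.factorOfG O L)) := rfl

/-- **The pieces imply the one Boolean**: `PassesG → checkG = true`. [cite: Rump2006PosDef, §2] -/
theorem checkG_of_passesG {O : CodedCluster} {a b p q Q : ℕ} {L : List ℕ}
    (h : C.PassesG O a b p q Q L) : C.checkG O a b p q Q L = true := by
  obtain ⟨hb, hr⟩ := h
  have hb' := hb
  simp only [checkBaseG, Bool.and_eq_true, decide_eq_true_eq, beq_iff_eq] at hb'
  obtain ⟨⟨⟨⟨⟨⟨⟨⟨_, _⟩, _⟩, _⟩, _⟩, _⟩, hlen⟩, _⟩, _⟩ := hb'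
  have hlenRA : (C.rowsOfG O L).length = (C.factorOfG O L).length := by
    rw [rowsOfG, O.length_rowsA, hlen]
  have hdd : ddAllN C.y C.x (C.x * (L.length - 1)) C.O (2 ^ (C.y - 1)) L.length (C.factorOfG O L) 0
      (C.rowsOfG O L) (C.factorOfG O L) = true :=
    ddAllN_of_rows' _ _ _ _ _ _ _ 0 _ _ hlenRA fun k hk => by
      have := hr k (by rw [hlen] at hk; exact hk)
      rw [rowPassG] at this
      rw [zero_add]
      exact this
  rw [checkG_eq', hb, hdd, Bool.true_and]

/-- **The one Boolean implies the pieces** (so small sectors may keep using `checkG`). [cite: Rump2006PosDef, §2] -/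
theorem passesG_of_checkG {O : CodedCluster} {a b p q Q : ℕ} {L : List ℕ}
    (h : C.checkG O a b p q Q L = true) : C.PassesG O a b p q Q L := by
  rw [checkG_eq', Bool.and_eq_true] at h
  obtain ⟨hb, hdd⟩ := h
  refine ⟨hb, ?_⟩
  have hb' := hb
  simp only [checkBaseG, Bool.and_eq_true, decide_eq_true_eq, beq_iff_eq] at hb'
  obtain ⟨⟨⟨⟨⟨⟨⟨⟨_, _⟩, _⟩, _⟩, _⟩, _⟩, hlen⟩, _⟩, _⟩ := hb'
  have hlenRA : (C.rowsOfG O L).length = (C.factorOfG O L).length := by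
    rw [rowsOfG, O.length_rowsA, hlen]
  intro i hi
  rw [rowPassG]
  have hi' : i < (C.factorOfG O L).length := by rw [hlen]; exact hi
  have := ddAllN_spec' C.y C.x (C.x * (L.length - 1)) C.O (2 ^ (C.y - 1)) L.length (C.factorOfG O L) 0 _ _
    hlenRA hdd i hi'
  rwa [zero_add] at this

variable {a b : ℕ} {O : CodedCluster} {hz : ℕ → ℕ → ℤ} {Q : ℕ}
  {H : Matrix (Finset (Orb (Fin a ×ₗ Fin b))) (Finset (Orb (Fin a ×ₗ Fin b))) ℂ}

/-- **SOUNDNESS in pieces** (generic): `O.Models a b hz Q H`, `PassesG ⇒ (c/Q)·‖v‖² ≤ re⟨v, H v⟩` on the spin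
sector. [cite: KullEtAl2024, §5.3] -/
theorem soundG₂ (hM : O.Models a b hz Q H) {p q : ℕ} {L : List ℕ} (h : C.PassesG O a b p q Q L)
    (v : Fock (Orb (Fin a ×ₗ Fin b))) (hv : ∀ s, ¬((upPart s).card = p ∧ (downPart s).card = q) → v s = 0) :
    ((C.floor Q : ℚ) : ℝ) * (star v ⬝ᵥ v).re ≤ (star v ⬝ᵥ (H *ᵥ v)).re :=
  C.soundG hM (C.checkG_of_passesG h) v hv

end KCert

/-! ### §2 From sector certificates to `N`-sector floors -/

section Assembly

variable {a b : ℕ} {O : CodedCluster} {hz : ℕ → ℕ → ℤ} {Q : ℕ}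
  {H : Matrix (Finset (Orb (Fin a ×ₗ Fin b))) (Finset (Orb (Fin a ×ₗ Fin b))) ℂ}

/-- Norms are nonnegative: `0 ≤ re ⟨v, v⟩`. [folklore] -/
private theorem star_dotProduct_self_re_nonneg' (v : Fock (Orb (Fin a ×ₗ Fin b))) : 0 ≤ (star v ⬝ᵥ v).re := by
  rw [dotProduct, Complex.re_sum]
  exact Finset.sum_nonneg fun s _ => by
    rw [Pi.star_apply, mul_comm, RCLike.star_def, Complex.mul_conj]; simp [Complex.normSq_nonneg]

/-- **Certificate form (generic).** For a cluster Hamiltonian `H` on the open `a × b` box modelled by the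
coded oracle `O` (`O.Models a b hz Q H`) and a particle number `k ≤ 2ab`: if for every `p ≤ k` a data-free
certificate `certs p` with the supplied code list `Ls p` of the spin sector `(p, k − p)` passes the generic
kernel checker and its floor is `≥ σ`, then `σ ≤ E₀(H, k)` — the hypothesis of the cluster lower bounds.
[cite: KullEtAl2024, §5.3] [cite: Anderson1951, eq. (2)] -/
theorem groundEnergy_ge_of_kCertsG (hM : O.Models a b hz Q H) {k : ℕ} (hk : k ≤ 2 * (a * b))
    (σ : ℚ) (Ls : ℕ → List ℕ) (certs : ℕ → KCert)
    (hcheck : ∀ p ≤ k, (certs p).checkG O a b p (k - p) Q (Ls p) = true)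
    (hσ : ∀ p ≤ k, σ ≤ (certs p).floor Q) :
    (σ : ℝ) ≤ groundEnergy H k := by
  have hc : Fintype.card (Orb (Fin a ×ₗ Fin b)) = a * b * 2 := by
    simp [Fintype.card_prod, Fintype.card_lex, Fintype.card_fin]
  have hcard : k ≤ Fintype.card (Orb (Fin a ×ₗ Fin b)) := by rw [hc]; omega
  refine le_groundEnergy_of_spinSectorFloors _ hM.preserves hcard σ ?_
  intro p q hpq v hv
  have hp : p ≤ k := by omega
  have hq : q = k - p := by omega
  subst hq
  have hs := (certs p).soundG hM (hcheck p hp) v hv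
  have hfl : (σ : ℝ) ≤ (((certs p).floor Q : ℚ) : ℝ) := by exact_mod_cast hσ p hp
  exact le_trans (mul_le_mul_of_nonneg_right hfl (star_dotProduct_self_re_nonneg' v)) hs

/-- **Certificate form with the spin-exchange symmetry (generic).** For a spin-exchange-invariant `H`
(`relabel Orb.spinSwap H = H`) modelled by `O`: if for every `p ≤ k` with `p ≤ k − p` a data-free certificate of
the spin sector `(p, k − p)` passes the generic checker and its floor is `≥ σ`, then `σ ≤ E₀(H, k)` (the sectors
with `p > k − p` are the spin-exchange images of certified ones). [cite: KullEtAl2024, §5.3] [cite: LiebPRL1989, proof of Theorem 1] -/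
theorem groundEnergy_ge_of_kCertsG₂ (hM : O.Models a b hz Q H)
    (hH : relabel (Orb.spinSwap : Orb (Fin a ×ₗ Fin b) ≃ Orb (Fin a ×ₗ Fin b)) H = H)
    {k : ℕ} (hk : k ≤ 2 * (a * b)) (σ : ℚ) (Ls : ℕ → List ℕ) (certs : ℕ → KCert)
    (hcheck : ∀ p ≤ k, p ≤ k - p → (certs p).checkG O a b p (k - p) Q (Ls p) = true)
    (hσ : ∀ p ≤ k, p ≤ k - p → σ ≤ (certs p).floor Q) :
    (σ : ℝ) ≤ groundEnergy H k := by
  have hc : Fintype.card (Orb (Fin a ×ₗ Fin b)) = a * b * 2 := by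
    simp [Fintype.card_prod, Fintype.card_lex, Fintype.card_fin]
  have hcard : k ≤ Fintype.card (Orb (Fin a ×ₗ Fin b)) := by rw [hc]; omega
  refine le_groundEnergy_of_spinSectorFloors _ hM.preserves hcard σ ?_
  -- a certified sector gives the floor `σ` directly
  have direct : ∀ p ≤ k, p ≤ k - p → ∀ v : Fock (Orb (Fin a ×ₗ Fin b)),
      (∀ s, ¬((upPart s).card = p ∧ (downPart s).card = k - p) → v s = 0) →
      (σ : ℝ) * (star v ⬝ᵥ v).re ≤ (star v ⬝ᵥ (H *ᵥ v)).re := by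
    intro p hp hpp v hv
    have hs := (certs p).soundG hM (hcheck p hp hpp) v hv
    have hfl : (σ : ℝ) ≤ (((certs p).floor Q : ℚ) : ℝ) := by exact_mod_cast hσ p hp hpp
    exact le_trans (mul_le_mul_of_nonneg_right hfl (star_dotProduct_self_re_nonneg' v)) hs
  intro p q hpq v hv
  by_cases hle : p ≤ q
  · have hp : p ≤ k := by omega
    have hq : q = k - p := by omega
    subst hq
    exact direct p hp hle v hv
  · have hq : q ≤ k := by omega
    have hqq : q ≤ k - q := by omega
    have hp : p = k - q := by omega
    subst hp
    exact sectorFloor_spinSwap _ hH (direct q hq hqq) v hv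

/-- **Certificate form in pieces with the spin-exchange symmetry (generic).** As `groundEnergy_ge_of_kCertsG₂`,
with the hypotheses `PassesG` (base + row blocks) instead of the one Boolean.
[cite: KullEtAl2024, §5.3] [cite: LiebPRL1989, proof of Theorem 1] -/
theorem groundEnergy_ge_of_kCertsG₃ (hM : O.Models a b hz Q H)
    (hH : relabel (Orb.spinSwap : Orb (Fin a ×ₗ Fin b) ≃ Orb (Fin a ×ₗ Fin b)) H = H)
    {k : ℕ} (hk : k ≤ 2 * (a * b)) (σ : ℚ) (Ls : ℕ → List ℕ) (certs : ℕ → KCert)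
    (hpass : ∀ p ≤ k, p ≤ k - p → (certs p).PassesG O a b p (k - p) Q (Ls p))
    (hσ : ∀ p ≤ k, p ≤ k - p → σ ≤ (certs p).floor Q) :
    (σ : ℝ) ≤ groundEnergy H k :=
  groundEnergy_ge_of_kCertsG₂ hM hH hk σ Ls certs (fun p hp hpp => (certs p).checkG_of_passesG (hpass p hp hpp)) hσ

end Assembly

end OccupationCode

end Literature.MathematicalPhysics.QuantumLattice
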